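import Summits.BirchSwinnertonDyer.Rank1Residual.X2.ResidualSelmerFinite
import Summits.BirchSwinnertonDyer.BirchSwinnertonDyer.Theorems.ByReductionTypeAtTwoMultTransportKlein
import Summits.BirchSwinnertonDyer.BirchSwinnertonDyer.Theorems.ByReductionTypeAtTwoMultTransportLines
import Summits.BirchSwinnertonDyer.BirchSwinnertonDyer.Theorems.ByReductionTypeAtTwoMultTransportArch
import HarnessLib

/-!
# Greenberg's Prop. 5.14 at `p = 2` as a kernel theorem, file F2: the rational line `Φ = ⟨P⟩ ≤ E[2]` of a
# rational point of order `2` — stability, trivial action on `Φ` and on `E[2]/Φ`, and its position w.r.t. a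
# Greenberg datum (`Φ = C[2]` or `Φ ∩ C[2] = 0`)

Cell `bsd-2adic`, seat `bsd-2adic-t42` GEN 27 (road «H514-KERNEL»; `--supports` stmt-BirchSwinnertonDyer-19923).
HONEST FRAMING: research route; theorems only (no `def`, no named fact, nothing booked); BSD is not proved.

For `E/ℚ` and a non-zero `Γ_ℚ`-fixed `P ∈ E[2](ℚ̄)`, the subgroup `Φ₀ = ℤ·P` is a rational line
(`isRationalLine_zmultiples`), its transport `S = lineSub Φ₀` to `E[2^∞][2]` is `{0, P}` (`mem_lineSub_zmultiples_iff`),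
`Γ_ℚ` acts TRIVIALLY on `S` (`smul_sub_eq_self_of_zmultiples`) and on `E[2^∞][2]/S` (`smul_quot_eq_self_of_zmultiples`:
`σ • T − T ∈ {0, P}`, t42 `smul_eq_self_or_eq_add`), both have order `2`; and for a Greenberg datum `N` above `2` whose
residual line `C ∩ E[2^∞][2]` has order `2`: `P ∈ C ⟹ (torsionDatum N 2).plus = S` (`torsionDatum_plus_eq_lineSub_of_mem`),
`P ∉ C ⟹ S ≅ E[2^∞][2]/C[2]` (`bijective_grMk_incl_of_not_mem`) — the two shapes «`Φ = C₂[2]`» / «`Φ ∩ C₂ = 0`» of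
Greenberg's proof of Prop. 5.14.

References: [GreenbergLNM1716] §5 proof of Prop. 5.14 (p. 122), proof of Prop. 5.10 (pp. 147–148);
[GreenbergVatsal2000] §2 p. 28; [SilvermanAEC2009] III.6.4, VIII.1.
-/

set_option autoImplicit false
set_option linter.dupNamespace false

noncomputable section

open scoped Classical AddSubgroup

namespace Summit.BirchSwinnertonDyer.BirchSwinnertonDyer.Theorems.Prop514AtTwo

open NumberField IsDedekindDomain Field Literature.NumberTheory.GaloisRepresentations
  Literature.NumberTheory.EllipticCurves Literature.NumberTheory.EllipticCurves.GreenbergSelmer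
  Literature.NumberTheory.EllipticCurves.Rank1Residual
  Summit.BirchSwinnertonDyer.Rank1Residual.X2.GreenbergVatsalTorsion
  Summit.BirchSwinnertonDyer.Rank1Residual.X2.ResidualDevissageModules
  Summit.BirchSwinnertonDyer.Rank1Residual.X2.ResidualDevissageLine
  Summit.BirchSwinnertonDyer.BirchSwinnertonDyer.Theorems.MultTransportAtTwo
  WeierstrassCurve

variable (W : WeierstrassCurve ℚ) [W.IsElliptic] {P : W.geomTorsion 2} (hP0 : P ≠ 0)
  (hPσ : ∀ σ : absoluteGaloisGroup ℚ, σ • P = P)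

/-! ## §1 The rational line `ℤ·P` -/

omit [W.IsElliptic] in
/-- `ℤ·P = {0, P}` for a point of order `2`. [folklore] -/
theorem mem_zmultiples_two_iff (Q : W.geomTorsion 2) : Q ∈ AddSubgroup.zmultiples P ↔ Q = 0 ∨ Q = P := by
  have hP2 : P + P = 0 := add_self_geomTorsion_two W P
  constructor
  · rintro ⟨k, rfl⟩
    rcases Int.even_or_odd k with ⟨j, rfl⟩ | ⟨j, rfl⟩
    · left
      change (j + j) • P = 0
      rw [add_zsmul, ← zsmul_add, hP2, zsmul_zero]
    · right
      change (2 * j + 1) • P = P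
      rw [add_zsmul, one_zsmul, mul_comm, mul_zsmul, two_zsmul, hP2, zsmul_zero, zero_add]
  · rintro (rfl | h)
    · exact AddSubgroup.zero_mem _
    · rw [h]; exact AddSubgroup.mem_zmultiples P

include hP0 in
omit [W.IsElliptic] in
/-- `#(ℤ·P) = 2` for a non-zero point of order `2`. [folklore] -/
theorem natCard_zmultiples_two : Nat.card (AddSubgroup.zmultiples P) = 2 := by
  rw [Nat.card_zmultiples]
  haveI : Fact (Nat.Prime 2) := ⟨Nat.prime_two⟩
  exact addOrderOf_eq_prime (by rw [two_nsmul]; exact add_self_geomTorsion_two W P) hP0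

include hP0 hPσ in
omit [W.IsElliptic] in
/-- **`ℤ·P` is a rational line** (order `2`, `Γ_ℚ`-stable) for a non-zero rational `P ∈ E[2]`.
[cite: GreenbergLNM1716, §5 Prop. 5.14 (the line `Φ`)] -/
theorem isRationalLine_zmultiples : IsRationalLine W 2 (AddSubgroup.zmultiples P) := by
  refine ⟨natCard_zmultiples_two W hP0, fun σ Q hQ ↦ ?_⟩
  rcases (mem_zmultiples_two_iff W Q).1 hQ with rfl | h
  · rw [smul_zero]; exact AddSubgroup.zero_mem _
  · rw [h, hPσ σ]; exact AddSubgroup.mem_zmultiples P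

omit [W.IsElliptic] in
/-- Membership in the transported line: `m ∈ S ⟺ m = 0 ∨ m = P`. [folklore] -/
theorem mem_lineSub_zmultiples_iff (hΦ : IsRationalLine W 2 (AddSubgroup.zmultiples P))
    (m : ↥((↥(W.geomPrimaryTorsion 2))[(2 : ℤ)])) :
    m ∈ (lineSub (AddSubgroup.zmultiples P) hΦ).toAddSubgroup ↔ m = 0 ∨ m = torsionToPrimary W 2 P := by
  obtain ⟨Q, rfl⟩ := (torsionToPrimary_bijective W 2).2 m
  rw [torsionToPrimary_mem_lineSub_iff, mem_zmultiples_two_iff]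
  refine or_congr ⟨fun h ↦ by rw [h, map_zero], fun h ↦ ?_⟩ ⟨fun h ↦ by rw [h], fun h ↦ ?_⟩
  · exact (torsionToPrimary_bijective W 2).1 (by rw [h, map_zero])
  · exact (torsionToPrimary_bijective W 2).1 h

include hPσ in
omit [W.IsElliptic] in
/-- **`Γ_ℚ` acts trivially on `Φ = {0, P}`.** [cite: GreenbergLNM1716, §5 Prop. 5.14] -/
theorem smul_sub_eq_self_of_zmultiples (hΦ : IsRationalLine W 2 (AddSubgroup.zmultiples P))
    (g : absoluteGaloisGroup ℚ) (x : (lineSub (AddSubgroup.zmultiples P) hΦ).Sub) : g • x = x := by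
  revert x
  rw [StableSubgroup.forall_smul_sub_eq_self_iff]
  intro m hm
  rcases (mem_lineSub_zmultiples_iff W hΦ m).1 hm with rfl | h
  · rw [smul_zero]
  · rw [h, ← torsionToPrimary_smul, hPσ g]

include hP0 hPσ in
/-- **`Γ_ℚ` acts trivially on `Ψ = E[2]/Φ`**: `σ • T − T ∈ {0, P}` for every `T ∈ E[2]` (the tree's
`smul_eq_self_or_eq_add`: `Γ_ℚ` fixes `P` and permutes the four points). [cite: GreenbergLNM1716, §5 Prop. 5.14]
[cite: SilvermanAEC2009, X.4 Prop. 4.9] -/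
theorem smul_quot_eq_self_of_zmultiples (hΦ : IsRationalLine W 2 (AddSubgroup.zmultiples P))
    (g : absoluteGaloisGroup ℚ) (y : (lineSub (AddSubgroup.zmultiples P) hΦ).Quot) : g • y = y := by
  revert y
  rw [StableSubgroup.forall_smul_quot_eq_self_iff]
  intro m
  obtain ⟨T, rfl⟩ := (torsionToPrimary_bijective W 2).2 m
  rw [← torsionToPrimary_smul, ← map_sub, torsionToPrimary_mem_lineSub_iff, mem_zmultiples_two_iff]
  rcases smul_eq_self_or_eq_add W hP0 hPσ g T with h | h
  · left; rw [h, sub_self]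
  · right; rw [h, add_sub_cancel_left]

include hP0 in
omit [W.IsElliptic] in
/-- `#Φ = 2`. [folklore] -/
theorem natCard_sub_zmultiples (hΦ : IsRationalLine W 2 (AddSubgroup.zmultiples P)) :
    Nat.card (lineSub (AddSubgroup.zmultiples P) hΦ).Sub = 2 := by
  change Nat.card ↥((AddSubgroup.zmultiples P).map (torsionToPrimary W 2)) = 2
  rw [AddSubgroup.card_map_of_injective (torsionToPrimary_bijective W 2).1]
  exact natCard_zmultiples_two W hP0

include hP0 in
/-- `#(E[2]/Φ) = 2` (`#E[2^∞][2] = 4`). [folklore] -/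
theorem natCard_quot_zmultiples (hΦ : IsRationalLine W 2 (AddSubgroup.zmultiples P)) :
    Nat.card (lineSub (AddSubgroup.zmultiples P) hΦ).Quot = 2 := by
  have h := (lineSub (AddSubgroup.zmultiples P) hΦ).natCard_eq_mul
  have h4 : Nat.card ↥((↥(W.geomPrimaryTorsion 2))[((2 : ℕ) : ℤ)]) = 4 :=
    natCard_torsionBy_two_geomPrimaryTorsion W
  rw [h4, natCard_sub_zmultiples W hP0 hΦ] at h
  omega

/-! ## §2 Position of the line w.r.t. a Greenberg datum above `2` -/

variable {v : HeightOneSpectrum (𝓞 ℚ)} (N : LocalDatum ℚ (W.geomPrimaryTorsion 2) v)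
  (hcard : Nat.card ↥(N.plus ⊓ (↥(W.geomPrimaryTorsion 2))[(2 : ℤ)]) = 2)

include hP0 hcard in
omit [W.IsElliptic] in
/-- **`P ∈ C ⟹ C ∩ E[2^∞][2] = Φ`** (two subgroups of order `2` sharing the non-zero `P`): Greenberg's
«`Φ = C₂[2]`», the residual datum IS the rational line. [cite: GreenbergLNM1716, §5 proof of Prop. 5.14 (p. 122)]
[cite: GreenbergVatsal2000, §2 p. 28] -/
theorem torsionDatum_plus_eq_lineSub_of_mem (hΦ : IsRationalLine W 2 (AddSubgroup.zmultiples P))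
    (hPC : ((torsionToPrimary W 2 P : (↥(W.geomPrimaryTorsion 2))[(2 : ℤ)]) : W.geomPrimaryTorsion 2) ∈ N.plus) :
    (torsionDatum N 2).plus = (lineSub (AddSubgroup.zmultiples P) hΦ).toAddSubgroup := by
  have hT : Nat.card (torsionDatum N 2).plus = 2 := by
    change Nat.card (N.plus.addSubgroupOf _) = 2
    rw [natCard_addSubgroupOf_torsionBy]; exact hcard
  have hPT : torsionToPrimary W 2 P ∈ (torsionDatum N 2).plus := (AddSubgroup.mem_addSubgroupOf).2 hPC
  have hP0' : torsionToPrimary W 2 P ≠ 0 := fun h ↦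
    hP0 ((torsionToPrimary_bijective W 2).1 (by rw [h, map_zero]))
  ext m
  rw [mem_lineSub_zmultiples_iff]
  constructor
  · exact fun hm ↦ eq_zero_or_eq_of_natCard_eq_two hT hPT hP0' hm
  · rintro (rfl | h)
    · exact AddSubgroup.zero_mem _
    · rw [h]; exact hPT

include hP0 hcard in
/-- **`P ∉ C ⟹ Φ ≅ E[2^∞][2] / (C ∩ E[2^∞][2])`** (injective: `Φ ∩ C = 0`; onto: both sides have two
elements): Greenberg's «`Φ ∩ C₂ = 0`, so `Φ` can be identified with `D[2]`». [cite: GreenbergLNM1716, §5 proof of Prop. 5.10 (p. 148) and of Prop. 5.14 (p. 122)] -/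
theorem bijective_grMk_incl_of_not_mem (hΦ : IsRationalLine W 2 (AddSubgroup.zmultiples P))
    (hPC : ((torsionToPrimary W 2 P : (↥(W.geomPrimaryTorsion 2))[(2 : ℤ)]) : W.geomPrimaryTorsion 2) ∉ N.plus) :
    Function.Bijective fun x : (lineSub (AddSubgroup.zmultiples P) hΦ).Sub ↦
      (torsionDatum N 2).grMk ((lineSub (AddSubgroup.zmultiples P) hΦ).incl x) := by
  set S := lineSub (AddSubgroup.zmultiples P) hΦ with hSdef
  have hT : Nat.card (torsionDatum N 2).plus = 2 := by
    change Nat.card (N.plus.addSubgroupOf _) = 2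
    rw [natCard_addSubgroupOf_torsionBy]; exact hcard
  -- injective
  have hinj : Function.Injective fun x : S.Sub ↦ (torsionDatum N 2).grMk (S.incl x) := by
    intro x x' hxx'
    have h0 : (torsionDatum N 2).grMk (S.incl (x - x')) = 0 := by
      rw [map_sub, map_sub, sub_eq_zero]; exact hxx'
    rw [← AddMonoidHom.mem_ker, LocalDatum.ker_grMk] at h0
    have hmem : S.incl (x - x') ∈ S.toAddSubgroup := (x - x').2
    rcases (mem_lineSub_zmultiples_iff W hΦ _).1 hmem with h | h
    · exact sub_eq_zero.1 (S.incl_injective (by rw [h, map_zero]))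
    · exfalso
      rw [h] at h0
      exact hPC ((AddSubgroup.mem_addSubgroupOf).1 h0)
  -- cardinalities: `#Φ = 2 = #(E[2^∞][2] / C[2])`
  haveI : Finite ↥((↥(W.geomPrimaryTorsion 2))[(2 : ℤ)]) :=
    Nat.finite_of_card_ne_zero (by rw [natCard_torsionBy_two_geomPrimaryTorsion W]; norm_num)
  haveI : Finite (torsionDatum N 2).Gr := Quotient.finite _
  refine hinj.bijective_of_nat_card_le ?_
  have hq := (torsionDatum N 2).plus.card_eq_card_quotient_mul_card_addSubgroup
  have h4 : Nat.card ↥((↥(W.geomPrimaryTorsion 2))[((2 : ℕ) : ℤ)]) = 4 :=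
    natCard_torsionBy_two_geomPrimaryTorsion W
  rw [h4, hT] at hq
  change Nat.card (torsionDatum N 2).Gr ≤ _
  rw [natCard_sub_zmultiples W hP0 hΦ]
  change Nat.card (↥((↥(W.geomPrimaryTorsion 2))[((2 : ℕ) : ℤ)]) ⧸ (torsionDatum N 2).plus) ≤ 2
  omega

end Summit.BirchSwinnertonDyer.BirchSwinnertonDyer.Theorems.Prop514AtTwo

end
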